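import Literature.Analysis.FluidPDE.LeiZhang2011Proofs
import Mathlib.Analysis.FunctionalSpaces.SobolevInequality
import HarnessLib

/-!
# Lei–Zhang 2011, §2: the pointwise gradient bound behind the Sobolev step of (2.5)

Analysis/FluidPDE proofs file (theorems only), on the discharge path of the named fact
`Literature.Analysis.FluidPDE.LeiZhang2011_liouville` (Z. Lei, Q. S. Zhang, J. Funct. Anal. 261
(2011) = arXiv:1011.5066, Theorem 1.2 via Theorem 1.1, §2). After the energy inequality (2.4)
the paper applies "Hölder inequality and Sobolev imbedding theorem" to `ψ_R f`, `f = |Γ|^q`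
(p. 7, display before (2.5)). In the tree the energy inequality is written for `H = h²`
(`h = |·|^q` there) with the good term `∫ H''(F)‖∇F‖²φ²`; the link to `‖∇(φ h(F))‖²`, which is
what Sobolev consumes, is the pointwise bound

`‖∇(φ · h∘F)‖² ≤ H''(F) ‖∇F‖² φ² + 2 H(F) ‖∇φ‖²`, `H = h²`, provided `h h'' ≥ 0`

(`LeiZhang2011.norm_gradient_mul_comp_sq_le`: `∇(φ h(F)) = h(F)∇φ + φ h'(F)∇F`,
`‖a + b‖² ≤ 2‖a‖² + 2‖b‖²`, and `H'' = 2h'² + 2hh'' ≥ 2h'²`), together with the computation of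
`H'`, `H''` for `H = h²` (`LeiZhang2011.deriv_sq_comp`, `LeiZhang2011.deriv_deriv_sq_comp`).

## References

* Z. Lei, Q. S. Zhang, J. Funct. Anal. 261 (2011) = arXiv:1011.5066, §2, p. 7 (Sobolev step
  before (2.5)). [LeiZhang2011]
-/

noncomputable section

open MeasureTheory Set Function Filter Metric
open _root_.Topology
open scoped InnerProductSpace RealInnerProductSpace NNReal ENNReal

namespace Literature.Analysis.FluidPDE

namespace LeiZhang2011

/-- `(h²)' = 2 h h'` for `h` differentiable. [folklore] -/
theorem deriv_sq_comp {h : ℝ → ℝ} (hh : Differentiable ℝ h) (v : ℝ) :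
    deriv (fun t => h t ^ 2) v = 2 * h v * deriv h v := by
  have hd := ((hh v).hasDerivAt.pow 2).deriv
  have e : (fun t => h t ^ 2) = h ^ 2 := rfl
  rw [e, hd]
  simp

/-- `(h²)'' = 2 h'² + 2 h h''` for `h ∈ C²`. [folklore] -/
theorem deriv_deriv_sq_comp {h : ℝ → ℝ} (hh : ContDiff ℝ 2 h) (v : ℝ) :
    deriv (deriv fun t => h t ^ 2) v = 2 * deriv h v ^ 2 + 2 * h v * deriv (deriv h) v := by
  have hd : Differentiable ℝ h := hh.differentiable two_ne_zero
  have hd' : Differentiable ℝ (deriv h) := by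
    have h2 : ContDiff ℝ (1 + 1) h := by rw [one_add_one_eq_two]; exact hh
    exact h2.deriv'.differentiable one_ne_zero
  have hfun : deriv (fun t => h t ^ 2) = fun t => 2 * h t * deriv h t := funext (deriv_sq_comp hd)
  rw [hfun]
  have h1 : HasDerivAt (fun t => 2 * h t * deriv h t)
      (2 * deriv h v * deriv h v + 2 * h v * deriv (deriv h) v) v := by
    have ha : HasDerivAt (fun t => 2 * h t) (2 * deriv h v) v := (hd v).hasDerivAt.const_mul 2
    have hb : HasDerivAt (deriv h) (deriv (deriv h) v) v := (hd' v).hasDerivAt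
    exact ha.mul hb
  rw [h1.deriv]
  ring

/-- **The pointwise gradient bound behind the Sobolev step** (Lei–Zhang 2011, p. 7): for
`F ∈ C¹`, `h ∈ C²` with `h h'' ≥ 0` and `H = h²`, and `φ ∈ C¹`,
`‖∇(φ · h∘F)‖² ≤ H''(F) ‖∇F‖² φ² + 2 H(F) ‖∇φ‖²`
(`∇(φ h(F)) = h(F)∇φ + φ h'(F)∇F`, the parallelogram bound, and `H'' = 2h'² + 2hh'' ≥ 2h'²`). With
the energy inequality this bounds `∬‖∇(φ h(F))‖²`, the input of the Sobolev embedding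
`H¹(ℝ³) ⊂ L⁶(ℝ³)`. [cite: LeiZhang2011, §2 (arXiv p. 7), Sobolev step before (2.5)] -/
theorem norm_gradient_mul_comp_sq_le {F : EuclideanSpace ℝ (Fin 3) → ℝ} (hF : ContDiff ℝ 1 F)
    {h : ℝ → ℝ} (hh : ContDiff ℝ 2 h) (hhh : ∀ v, 0 ≤ h v * deriv (deriv h) v)
    {φ : EuclideanSpace ℝ (Fin 3) → ℝ} (hφ : ContDiff ℝ 1 φ) (x : EuclideanSpace ℝ (Fin 3)) :
    ‖gradient (fun y => φ y * h (F y)) x‖ ^ 2 ≤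
      deriv (deriv fun t => h t ^ 2) (F x) * ‖gradient F x‖ ^ 2 * φ x ^ 2 +
        2 * h (F x) ^ 2 * ‖gradient φ x‖ ^ 2 := by
  have hhd : Differentiable ℝ h := hh.differentiable two_ne_zero
  have hFd : DifferentiableAt ℝ F x := (hF.differentiable one_ne_zero) x
  have hφd : DifferentiableAt ℝ φ x := (hφ.differentiable one_ne_zero) x
  have hhF : DifferentiableAt ℝ (fun y => h (F y)) x := (hhd (F x)).comp x hFd
  -- `∇(φ h(F)) = φ h'(F) ∇F + h(F) ∇φ`
  have hgrad : gradient (fun y => φ y * h (F y)) x =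
      (φ x * deriv h (F x)) • gradient F x + h (F x) • gradient φ x := by
    have h1 : gradient (fun y => φ y * h (F y)) x =
        φ x • gradient (fun y => h (F y)) x + h (F x) • gradient φ x := by
      simp only [gradient, fderiv_fun_mul hφd hhF, map_add, map_smul]
    rw [h1, gradient_comp_apply (hhd (F x)) hFd, smul_smul]
  rw [hgrad, deriv_deriv_sq_comp hh]
  -- `‖a + b‖² ≤ 2‖a‖² + 2‖b‖²`
  have hpar : ‖(φ x * deriv h (F x)) • gradient F x + h (F x) • gradient φ x‖ ^ 2 ≤
      2 * ‖(φ x * deriv h (F x)) • gradient F x‖ ^ 2 + 2 * ‖h (F x) • gradient φ x‖ ^ 2 := by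
    have h0 := norm_add_le ((φ x * deriv h (F x)) • gradient F x) (h (F x) • gradient φ x)
    have ha := norm_nonneg ((φ x * deriv h (F x)) • gradient F x)
    have hb := norm_nonneg (h (F x) • gradient φ x)
    nlinarith [sq_nonneg (‖(φ x * deriv h (F x)) • gradient F x‖ - ‖h (F x) • gradient φ x‖),
      norm_nonneg ((φ x * deriv h (F x)) • gradient F x + h (F x) • gradient φ x)]
  refine hpar.trans ?_
  rw [norm_smul, norm_smul, Real.norm_eq_abs, Real.norm_eq_abs, mul_pow, mul_pow, sq_abs, sq_abs]
  have hkey : 2 * ((φ x * deriv h (F x)) ^ 2 * ‖gradient F x‖ ^ 2) ≤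
      (2 * deriv h (F x) ^ 2 + 2 * h (F x) * deriv (deriv h) (F x)) * ‖gradient F x‖ ^ 2 * φ x ^ 2 := by
    have h1 : 0 ≤ 2 * (h (F x) * deriv (deriv h) (F x)) * ‖gradient F x‖ ^ 2 * φ x ^ 2 :=
      mul_nonneg (mul_nonneg (mul_nonneg zero_le_two (hhh (F x))) (sq_nonneg _)) (sq_nonneg _)
    nlinarith [h1]
  nlinarith [hkey]

end LeiZhang2011

end Literature.Analysis.FluidPDE

namespace Literature.Analysis.FluidPDE

namespace LeiZhang2011

/-- **The pointwise gradient bound behind the Sobolev step, `C¹` form.** For `F ∈ C¹`, a `C¹`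
function `s` and a function `G` with `2 s'(v)² ≤ G(v)` (in applications `s² = H`, `G = H''`:
`s = |v|^{q-1}v`, `H = |v|^{2q}`, or `s = (v₊)^q`, `H = (v₊)^{2q}`, `q > 1`), and `φ ∈ C¹`:
`‖∇(φ · s∘F)‖² ≤ G(F) ‖∇F‖² φ² + 2 s(F)² ‖∇φ‖²`. This is the form used with the non-smooth
"square roots" `f = |Γ|^q` of Lei–Zhang 2011, §2 (p. 7, Sobolev step before (2.5)), which are
`C¹` but not `C²`. [cite: LeiZhang2011, §2 (arXiv p. 7), Sobolev step before (2.5)] -/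
theorem norm_gradient_mul_comp_sq_le' {F : EuclideanSpace ℝ (Fin 3) → ℝ} (hF : ContDiff ℝ 1 F)
    {s G : ℝ → ℝ} (hs : ContDiff ℝ 1 s) (hsG : ∀ v, 2 * deriv s v ^ 2 ≤ G v)
    {φ : EuclideanSpace ℝ (Fin 3) → ℝ} (hφ : ContDiff ℝ 1 φ) (x : EuclideanSpace ℝ (Fin 3)) :
    ‖gradient (fun y => φ y * s (F y)) x‖ ^ 2 ≤
      G (F x) * ‖gradient F x‖ ^ 2 * φ x ^ 2 + 2 * s (F x) ^ 2 * ‖gradient φ x‖ ^ 2 := by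
  have hsd : Differentiable ℝ s := hs.differentiable one_ne_zero
  have hFd : DifferentiableAt ℝ F x := (hF.differentiable one_ne_zero) x
  have hφd : DifferentiableAt ℝ φ x := (hφ.differentiable one_ne_zero) x
  have hsF : DifferentiableAt ℝ (fun y => s (F y)) x := (hsd (F x)).comp x hFd
  have hgrad : gradient (fun y => φ y * s (F y)) x =
      (φ x * deriv s (F x)) • gradient F x + s (F x) • gradient φ x := by
    have h1 : gradient (fun y => φ y * s (F y)) x =
        φ x • gradient (fun y => s (F y)) x + s (F x) • gradient φ x := by
      simp only [gradient, fderiv_fun_mul hφd hsF, map_add, map_smul]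
    rw [h1, gradient_comp_apply (hsd (F x)) hFd, smul_smul]
  rw [hgrad]
  have hpar : ‖(φ x * deriv s (F x)) • gradient F x + s (F x) • gradient φ x‖ ^ 2 ≤
      2 * ‖(φ x * deriv s (F x)) • gradient F x‖ ^ 2 + 2 * ‖s (F x) • gradient φ x‖ ^ 2 := by
    have h0 := norm_add_le ((φ x * deriv s (F x)) • gradient F x) (s (F x) • gradient φ x)
    have ha := norm_nonneg ((φ x * deriv s (F x)) • gradient F x)
    have hb := norm_nonneg (s (F x) • gradient φ x)
    nlinarith [sq_nonneg (‖(φ x * deriv s (F x)) • gradient F x‖ - ‖s (F x) • gradient φ x‖),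
      norm_nonneg ((φ x * deriv s (F x)) • gradient F x + s (F x) • gradient φ x)]
  refine hpar.trans ?_
  rw [norm_smul, norm_smul, Real.norm_eq_abs, Real.norm_eq_abs, mul_pow, mul_pow, sq_abs, sq_abs]
  have hkey : 2 * ((φ x * deriv s (F x)) ^ 2 * ‖gradient F x‖ ^ 2) ≤
      G (F x) * ‖gradient F x‖ ^ 2 * φ x ^ 2 := by
    have h1 := mul_le_mul_of_nonneg_right (hsG (F x))
      (mul_nonneg (sq_nonneg ‖gradient F x‖) (sq_nonneg (φ x)))
    nlinarith [h1]
  nlinarith [hkey]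

end LeiZhang2011

end Literature.Analysis.FluidPDE
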